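import Summits.NavierStokesRegularity.FluidComputer.ClayBlowupSingularSliceHausdorffOneForced
import HarnessLib

/-!
# DISSIPATION CONCENTRATES AT EVERY SINGULAR POINT OF A CLAY BLOW-UP: the parabolic one-dimensional
# density of `∬ |∇u|²` at `(T, x₀)` is at least `ε(ν) > 0` (CKN's Proposition 2 at the blow-up time,
# WITH the Clay force)

Cell `ns-blowup`, seat `ns-blowup-ecbridge-2` (g8; the E–C endpoint theory seat). LABEL: E–C typing
(KERNEL — no named fact). WHAT THIS IS NOT: not Navier–Stokes evidence — a necessary condition on the
TYPES `ClayBlowup ν` / `DesignedBlowup ν` (no inhabitant is claimed anywhere). Companion memo: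
`run/shared/lean/pub/ns-blowup/ecbridge2/ECBRIDGE-2-MEMO-7.md`.

## Content

g7 used the FORCED gradient criterion at the top of a backward cylinder (`tsai1998_lemma42_forced`,
CKN's Proposition 2 / Tsai 1998 Lemma 4.2 with a solenoidal-or-not `L³` force, every viscosity) only
through its covering consequence `μH[1] S_T = 0`. This file states the criterion itself as a row on the
type — the GRADIENT companion of g6's `ckn_concentration` (which is the `|u|³ + |p|^{3/2}` form):

* `ClayBlowup.setLIntegral_gradient_eq_fderiv` — on the cylinder `Q_ρ(T, c)`, `ρ² ≤ T`, any weak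
  spatial gradient `G` of `u` agrees a.e. with the classical derivative `x ↦ D(u t)(x)` (`u` is `C^∞`
  below `T`; `HasWeakSpatialGradientOn.ae_eq`), so the dissipation integrals over sub-cylinders are the
  classical ones;
* **`ClayBlowup.dissipation_concentration`** — there is `ε = ε(ν) > 0` such that at EVERY point `x₀`
  of the singular slice `S_T = {x₀ | ¬ IsBackwardBoundedAt u T x₀}`,
  `limsup_{r → 0⁺} r⁻¹ ∬_{Q_r(T, x₀)} |∇u|² > ε` (Hilbert–Schmidt norm `frobeniusNormSq`,
  `Q_r(T, x₀) = (T − r², T) × B(x₀, r)`): otherwise the forced Tsai/CKN criterion on `Q_{√(T/2)}(T, x₀)`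
  (`exists_isLRSuitableWeakSolutionOn_cylinder_top`, g6) makes `u` essentially bounded near `(T, x₀)`,
  against `isBackwardSingularPoint_of_not_isBackwardBoundedAt` (g7);
* `ClayBlowup.exists_dissipation_gt` — the kill form: for every `r₀ > 0` there is `r ∈ (0, r₀)` with
  `∬_{Q_r(T, x₀)} |∇u|² > ε r`, i.e. the viscous dissipation `ν ∬_{Q_r(T,x₀)} |∇u|²` spent inside the
  parabolic cylinder of scale `r` at the singular point exceeds `ν ε r` along a sequence of scales
  `r → 0` — while the TOTAL dissipation `ν ∫₀ᵀ∫ |∇u|²` is finite (`lintegral_dissipation_lt_top`, g4/g5);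
* the `DesignedBlowup` twins.

Design reading: a singularity of an E–C certificate is paid for in dissipation at the rate `≥ ν ε r` per
backward cylinder `Q_r(T, x₀)` along scales `r → 0`, uniformly in the design (ε depends on ν only).

References: L. Caffarelli, R. Kohn, L. Nirenberg, CPAM 35 (1982), Proposition 2 and §6
[cite: CaffarelliKohnNirenberg1982, Proposition 2]; T.-P. Tsai, ARMA 143 (1998), Lemma 4.2 and the
remark following it [cite: Tsai1998, Lemma 4.2]; P. G. Lemarié-Rieusset, *The Navier–Stokes Problem in
the 21st Century* (2016), Thm. 13.8 / Thm. 14.4 [cite: LemarieRieusset2016, Thm. 14.4]; C. L. Fefferman,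
Clay problem description, (C) [cite: FeffermanClay2006, (C)].
-/

noncomputable section

namespace Summit.NavierStokesRegularity.FluidComputer

open Set MeasureTheory Filter Topology Function Metric TopologicalSpace
open scoped ENNReal ContDiff NNReal
open Literature.Analysis.FluidPDE
open Summit.NavierStokesRegularity.NavierStokesRegularity

namespace ClayBlowup

variable {ν : ℝ} (X : ClayBlowup ν)

/-! ## §1 The weak gradient on a top cylinder is the classical derivative -/

/-- **On a backward cylinder `Q_ρ(T, c)` with `ρ² ≤ T`, every weak spatial gradient of the velocity of
a Clay blow-up agrees a.e. with the classical derivative** (`u` is smooth on `(0, T) × ℝ³ ⊇ Q_ρ(T, c)`,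
so `x ↦ D(u t)(x)` is itself a weak spatial gradient there, and weak gradients are a.e. unique); hence
the gradient integrals over every measurable `s ⊆ Q_ρ(T, c)` coincide. [folklore] -/
theorem setLIntegral_gradient_eq_fderiv {ρ : ℝ} (hρT : ρ ^ 2 ≤ X.T) {c : EuclideanSpace ℝ (Fin 3)}
    {G : ℝ → EuclideanSpace ℝ (Fin 3) → EuclideanSpace ℝ (Fin 3) →L[ℝ] EuclideanSpace ℝ (Fin 3)}
    (hG : HasWeakSpatialGradientOn (parabolicCylinderOpens ρ ((X.T : ℝ), c)) X.u G)
    {s : Set (ℝ × EuclideanSpace ℝ (Fin 3))} (hs : s ⊆ parabolicCylinder ρ ((X.T : ℝ), c)) :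
    ∫⁻ w in s, ENNReal.ofReal (frobeniusNormSq (G w.1 w.2)) =
      ∫⁻ w in s, ENNReal.ofReal (frobeniusNormSq (fderiv ℝ (X.u w.1) w.2)) := by
  -- the classical derivative is a weak gradient on the cylinder
  have hQ : ((parabolicCylinderOpens ρ ((X.T : ℝ), c) : Opens (ℝ × EuclideanSpace ℝ (Fin 3))) :
      Set (ℝ × EuclideanSpace ℝ (Fin 3))) ⊆ Ioo 0 X.T ×ˢ univ := by
    intro w hw
    rw [coe_parabolicCylinderOpens, mem_parabolicCylinder] at hw
    exact ⟨⟨by nlinarith [hw.1.1], hw.1.2⟩, mem_univ _⟩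
  have hu : ContDiffOn ℝ 1 (uncurry X.u) (Ioo 0 X.T ×ˢ univ) :=
    (X.classical.smooth_velocity.of_le (by norm_cast)).mono
      (prod_mono Ioo_subset_Ico_self subset_rfl)
  have hF := hasWeakSpatialGradientOn_of_contDiffOn isOpen_Ioo hQ hu
  have hae := hG.ae_eq hF
  rw [coe_parabolicCylinderOpens] at hae
  have hae' := ae_restrict_of_ae_restrict_of_subset hs hae
  refine lintegral_congr_ae ?_
  filter_upwards [hae'] with w hw
  have hw' : G w.1 w.2 = fderiv ℝ (X.u w.1) w.2 := hw
  rw [hw']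

/-! ## §2 Dissipation concentration at every singular point -/

/-- **DISSIPATION CONCENTRATES AT EVERY SINGULAR POINT OF A CLAY BLOW-UP** (`ν > 0`; the force is the
Clay force of the type, no restriction; no named fact): there is `ε = ε(ν) > 0` such that for every
`x₀` of the singular slice, `limsup_{r → 0⁺} r⁻¹ ∬_{Q_r(T, x₀)} |∇u|² > ε` — CKN's Proposition 2 /
Tsai's Lemma 4.2 WITH force at the top of the cylinder `Q_{√(T/2)}(T, x₀)` (`tsai1998_lemma42_forced`
fed with `exists_isLRSuitableWeakSolutionOn_cylinder_top`), read contrapositively: a small parabolic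
density of the dissipation would make `u` essentially bounded near `(T, x₀)`
(`isBackwardSingularPoint_of_not_isBackwardBoundedAt`).
[cite: CaffarelliKohnNirenberg1982, Proposition 2] [cite: Tsai1998, Lemma 4.2] -/
theorem dissipation_concentration (hν : 0 < ν) :
    ∃ ε : ℝ, 0 < ε ∧ ∀ x₀ : EuclideanSpace ℝ (Fin 3), ¬ IsBackwardBoundedAt X.u X.T x₀ →
      ENNReal.ofReal ε <
        limsup (fun r : ℝ => (ENNReal.ofReal r)⁻¹ *
          ∫⁻ w in parabolicCylinder r ((X.T : ℝ), x₀),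
            ENNReal.ofReal (frobeniusNormSq (fderiv ℝ (X.u w.1) w.2))) (𝓝[>] (0 : ℝ)) := by
  have hT := X.T_pos
  obtain ⟨ε, hε, hTsai⟩ := tsai1998_lemma42_forced ν hν
  refine ⟨ε, hε, fun x₀ hx₀ => ?_⟩
  by_contra hle
  rw [not_lt] at hle
  -- the §14.3 datum on `Q_ρ(T, x₀)`, `ρ = √(T/2)`
  set ρ : ℝ := Real.sqrt (X.T / 2) with hρ
  have hρ0 : 0 < ρ := Real.sqrt_pos.2 (by positivity)
  have hρT : ρ ^ 2 ≤ X.T := by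
    rw [hρ, Real.sq_sqrt (by positivity)]
    linarith
  obtain ⟨G, hLR⟩ := X.exists_isLRSuitableWeakSolutionOn_cylinder_top hν x₀ hρ0 hρT
  -- the two parabolic densities agree for `0 < r < ρ`
  have hcongr : (fun r : ℝ => (ENNReal.ofReal r)⁻¹ *
      ∫⁻ w in parabolicCylinder r ((X.T : ℝ), x₀), ENNReal.ofReal (frobeniusNormSq (G w.1 w.2)))
        =ᶠ[𝓝[>] (0 : ℝ)]
      fun r : ℝ => (ENNReal.ofReal r)⁻¹ *
        ∫⁻ w in parabolicCylinder r ((X.T : ℝ), x₀),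
          ENNReal.ofReal (frobeniusNormSq (fderiv ℝ (X.u w.1) w.2)) := by
    filter_upwards [Ioo_mem_nhdsGT hρ0] with r hr
    have hsub : parabolicCylinder r ((X.T : ℝ), x₀) ⊆ parabolicCylinder ρ ((X.T : ℝ), x₀) := by
      intro w hw
      rw [mem_parabolicCylinder] at hw ⊢
      have : r ^ 2 ≤ ρ ^ 2 := pow_le_pow_left₀ hr.1.le hr.2.le 2
      exact ⟨⟨by linarith [hw.1.1], hw.1.2⟩, hw.2.trans hr.2⟩
    rw [X.setLIntegral_gradient_eq_fderiv hρT hLR.weakGradient hsub]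
  have hle' : limsup (fun r : ℝ => (ENNReal.ofReal r)⁻¹ *
      ∫⁻ w in parabolicCylinder r ((X.T : ℝ), x₀), ENNReal.ofReal (frobeniusNormSq (G w.1 w.2)))
        (𝓝[>] (0 : ℝ)) ≤ ENNReal.ofReal ε := by
    rw [limsup_congr hcongr]
    exact hle
  obtain ⟨r₁, hr₁, hbdd⟩ := hTsai ρ X.T x₀ X.f X.u _ G hρ0 hLR ((X.T : ℝ), x₀)
    ⟨by simp only; nlinarith, le_rfl⟩ (mem_ball_self hρ0) hle'
  exact hbdd.ne (X.isBackwardSingularPoint_of_not_isBackwardBoundedAt hx₀ r₁ hr₁)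

/-- **KILL FORM: the dissipation spent in `Q_r(T, x₀)` exceeds `ε r` along a sequence of scales
`r → 0`** (`ν > 0`; no named fact): for every singular point `x₀` of the final slice and every
`r₀ > 0` there is `r ∈ (0, r₀)` with `ε r < ∬_{Q_r(T, x₀)} |∇u|²`. The total dissipation
`∫₀ᵀ ∫ |∇u|²` being finite (`lintegral_dissipation_lt_top`), a singularity is a point where the
dissipation has positive upper parabolic 1-density. [cite: CaffarelliKohnNirenberg1982, Proposition 2]
[cite: Tsai1998, Lemma 4.2] -/
theorem exists_dissipation_gt (hν : 0 < ν) :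
    ∃ ε : ℝ, 0 < ε ∧ ∀ x₀ : EuclideanSpace ℝ (Fin 3), ¬ IsBackwardBoundedAt X.u X.T x₀ →
      ∀ r₀ : ℝ, 0 < r₀ → ∃ r ∈ Ioo 0 r₀,
        ENNReal.ofReal (ε * r) <
          ∫⁻ w in parabolicCylinder r ((X.T : ℝ), x₀),
            ENNReal.ofReal (frobeniusNormSq (fderiv ℝ (X.u w.1) w.2)) := by
  obtain ⟨ε, hε, h⟩ := X.dissipation_concentration hν
  refine ⟨ε, hε, fun x₀ hx₀ r₀ hr₀ => ?_⟩
  have hfreq := frequently_lt_of_lt_limsup (h := h x₀ hx₀)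
  obtain ⟨r, hlt, hr⟩ := (hfreq.and_eventually (Ioo_mem_nhdsGT hr₀)).exists
  refine ⟨r, hr, ?_⟩
  have hr0 : ENNReal.ofReal r ≠ 0 := (ENNReal.ofReal_pos.2 hr.1).ne'
  rw [mul_comm ((ENNReal.ofReal r)⁻¹), ← div_eq_mul_inv,
    ENNReal.lt_div_iff_mul_lt (Or.inl hr0) (Or.inl ENNReal.ofReal_ne_top)] at hlt
  rwa [ENNReal.ofReal_mul hε.le]

end ClayBlowup

/-! ## §3 The strong type -/

namespace DesignedBlowup

variable {ν : ℝ} (D : DesignedBlowup ν)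

/-- **Dissipation concentrates at every singular point of a designed blow-up** (`ν > 0`).
[cite: CaffarelliKohnNirenberg1982, Proposition 2] [cite: Tsai1998, Lemma 4.2] -/
theorem dissipation_concentration (hν : 0 < ν) :
    ∃ ε : ℝ, 0 < ε ∧ ∀ x₀ : EuclideanSpace ℝ (Fin 3), ¬ IsBackwardBoundedAt D.u D.T x₀ →
      ENNReal.ofReal ε <
        limsup (fun r : ℝ => (ENNReal.ofReal r)⁻¹ *
          ∫⁻ w in parabolicCylinder r ((D.T : ℝ), x₀),
            ENNReal.ofReal (frobeniusNormSq (fderiv ℝ (D.u w.1) w.2))) (𝓝[>] (0 : ℝ)) :=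
  D.toClayBlowup.dissipation_concentration hν

/-- **Kill form for a designed blow-up**: `ε r < ∬_{Q_r(T, x₀)} |∇u|²` along scales `r → 0` at every
singular point. [cite: CaffarelliKohnNirenberg1982, Proposition 2] [cite: Tsai1998, Lemma 4.2] -/
theorem exists_dissipation_gt (hν : 0 < ν) :
    ∃ ε : ℝ, 0 < ε ∧ ∀ x₀ : EuclideanSpace ℝ (Fin 3), ¬ IsBackwardBoundedAt D.u D.T x₀ →
      ∀ r₀ : ℝ, 0 < r₀ → ∃ r ∈ Ioo 0 r₀,
        ENNReal.ofReal (ε * r) <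
          ∫⁻ w in parabolicCylinder r ((D.T : ℝ), x₀),
            ENNReal.ofReal (frobeniusNormSq (fderiv ℝ (D.u w.1) w.2)) :=
  D.toClayBlowup.exists_dissipation_gt hν

end DesignedBlowup

end Summit.NavierStokesRegularity.FluidComputer

end
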